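import Literature.MathematicalPhysics.QuantumLattice.BCSPairHoppingCoulombReflectionPositivity
import HarnessLib

/-!
# Gaussian domination with the Coulomb repulsion: Koma 2022, Theorem 5.3 and (8.4), for the `π`-flux
# BCS model with `g' Σ Γ³_xΓ³_y` (Lieb frame)

T. Koma, *Nambu–Goldstone modes for superconducting lattice fermions*, arXiv:2201.13135 (2022)
[Koma2022], §8: "We write `H(B,0,g',h') := H(B) + H_repul(g',h')` … The same method as in Sec. 5 is
applicable again, and one has `Tr exp[-βH(B,0,g',h')] ≤ Tr exp[-βH(B,0,g',0)]` (8.4)". Here the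
Dyson–Lieb–Simon field is kept on the PAIR interaction (the field `h` of (3.5)/(5.50)) and the Coulomb
term carries no field (`h' = 0`) — this is the Gaussian domination needed for the infrared bound (6.4)
of the pair modes, hence for Theorem 2.1, in the presence of the repulsion `g' > 0`:

* `KomaPiFlux.hamiltonianC κ U g g' h B = KomaPiFlux.hamiltonian κ U g h B + g'Σ_{bonds}Γ³_xΓ³_y` — the
  `π`-flux model of `KomaPiFluxBCSModel.lean` with the Coulomb term of (2.6)/(8.1);
* `partitionFn_sq_le_coulomb` — (5.99) with the Coulomb term (from
  `PairHopCutRP.partitionFn_sq_le_reflected_coulomb`);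
* covariance: `PairHopRP.relabel_coulomb`, `orbitalPhaseAut_coulomb` (the Coulomb term is invariant
  under graph automorphisms and under every orbital gauge), `partitionFn_map_coulomb`,
  `partitionFn_translate_coulomb`, `partitionFn_rotateAxes_coulomb` ([Koma2022] §4);
* **`partitionFn_le_coulomb`** — `Z_β(T_π; U, g, g', h; B) ≤ Z_β(T_π; U, g, g', 0; B)` for every real pair
  field `h` (`κ, g, g' ≥ 0`, `β > 0`), by the descent `gaussianDomination_descent` of
  `KomaPiFluxGaussianDomination.lean`; ground-state form `groundEnergy_le_coulomb`.

No named fact.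

## References

* [Koma2022] T. Koma, arXiv:2201.13135, §4, Cor. 5.2 (5.99), Thm. 5.3 (5.100), §8 (8.1)–(8.4).
* [DLS1978] F. J. Dyson, E. H. Lieb, B. Simon, J. Stat. Phys. 18 (1978) 335, Thm. 4.2.
-/

noncomputable section

namespace Literature.MathematicalPhysics.QuantumLattice

open Matrix Finset HubbardWave0 NormedSpace PairHopRP LiebCutRP PairHopCutRP
open FermionTorus.Cut
open FermionTorus (shift unshift shiftEquiv shiftEquiv_apply)

/-! ### Covariance of the Coulomb term (generic graph) -/

namespace PairHopRP

section Relabel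

variable {Λ Λ' : Type*} [LinearOrder Λ] [Fintype Λ] [LinearOrder Λ'] [Fintype Λ']
  (G : SimpleGraph Λ) [DecidableRel G.Adj] (G' : SimpleGraph Λ') [DecidableRel G'.Adj]

/-- `Γ³_x ↦ Γ³_{f x}` under the relabelling. [cite: Koma2022, (4.2)] -/
theorem relabel_gammaThree (f : Λ ≃ Λ') (x : Λ) :
    relabel (Orb.mapEquiv f) (gammaThree x) = gammaThree (f x) := by
  rw [gammaThree, gammaThree, map_sub, map_sub, map_one, relabel_mapEquiv_numberOp, relabel_mapEquiv_numberOp]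

/-- **Covariance of the Coulomb term under graph isomorphisms.** [cite: Koma2022, §4.1 (4.2)–(4.4), (8.1)] -/
theorem relabel_coulomb (f : Λ ≃ Λ') (hG : ∀ x y, G'.Adj (f x) (f y) ↔ G.Adj x y) (g' : ℝ) :
    relabel (Orb.mapEquiv f) (coulomb G g') = coulomb G' g' := by
  rw [coulomb, coulomb, map_sum, ← f.sum_comp]
  refine Finset.sum_congr rfl fun x _ => ?_
  rw [map_sum, ← f.sum_comp]
  refine Finset.sum_congr rfl fun y _ => ?_
  by_cases hadj : G.Adj x y
  · rw [if_pos hadj, if_pos ((hG x y).2 hadj), coulombBond, coulombBond, map_smul, map_mul, relabel_gammaThree,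
      relabel_gammaThree]
  · rw [if_neg hadj, if_neg (fun h' => hadj ((hG x y).1 h')), map_zero]

/-- Covariance of `H(T, U; g, g', h; B)` under graph isomorphisms. [cite: Koma2022, §4.1 (4.2)–(4.4)] -/
theorem relabel_hamiltonianC (f : Λ ≃ Λ') (hG : ∀ x y, G'.Adj (f x) (f y) ↔ G.Adj x y)
    (T : Fin 2 → Λ → Λ → ℂ) (U g g' : ℝ) (h : Λ → Λ → ℝ) (B : ℝ) :
    relabel (Orb.mapEquiv f) (hamiltonianC G T U g g' h B) =
      hamiltonianC G' (fun σ x' y' => T σ (f.symm x') (f.symm y')) U g g'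
        (fun x' y' => h (f.symm x') (f.symm y')) B := by
  rw [hamiltonianC, hamiltonianC, map_add, relabel_hamiltonian G G' f hG, relabel_coulomb G G' f hG]

/-- Invariance of the partition function under graph isomorphisms. [cite: Koma2022, (4.3)–(4.4)] -/
theorem partitionFn_hamiltonianC_relabel (f : Λ ≃ Λ') (hG : ∀ x y, G'.Adj (f x) (f y) ↔ G.Adj x y)
    (T : Fin 2 → Λ → Λ → ℂ) (U g g' : ℝ) (h : Λ → Λ → ℝ) (B β : ℝ) :
    (hamiltonianC G' (fun σ x' y' => T σ (f.symm x') (f.symm y')) U g g'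
        (fun x' y' => h (f.symm x') (f.symm y')) B).partitionFn β =
      (hamiltonianC G T U g g' h B).partitionFn β := by
  rw [← relabel_hamiltonianC G G' f hG, partitionFn_relabel]

end Relabel

section Gauge

variable {Λ : Type*} [LinearOrder Λ] [Fintype Λ] (G : SimpleGraph Λ) [DecidableRel G.Adj]
variable {ph : Fin 2 → Λ → ℂ} (hph : ∀ σ x, ‖ph σ x‖ = 1) (hprod : ∀ x, ph 0 x * ph 1 x = 1)
include hph

/-- Every orbital gauge fixes `Γ³_x` (number operators are gauge invariant). [cite: Koma2022, §4.1–4.2] -/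
theorem orbitalPhaseAut_gammaThree (x : Λ) :
    orbitalPhaseAut (g := spinSitePhase ph) (fun _ => hph _ _) (gammaThree x) = gammaThree x := by
  rw [gammaThree, map_sub, map_sub, map_one, show numberOp x (0 : Fin 2) = numberAt (orb x 0) from rfl,
    show numberOp x (1 : Fin 2) = numberAt (orb x 1) from rfl, orbitalPhaseAut_numberAt, orbitalPhaseAut_numberAt]

/-- Every orbital gauge fixes the Coulomb term. [cite: Koma2022, §4.1–4.2, (8.1)] -/
theorem orbitalPhaseAut_coulomb (g' : ℝ) :
    orbitalPhaseAut (g := spinSitePhase ph) (fun _ => hph _ _) (coulomb G g') = coulomb G g' := by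
  rw [coulomb, map_sum]
  refine Finset.sum_congr rfl fun x _ => ?_
  rw [map_sum]
  refine Finset.sum_congr rfl fun y _ => ?_
  split_ifs
  · rw [coulombBond, map_smul, map_mul, orbitalPhaseAut_gammaThree hph, orbitalPhaseAut_gammaThree hph]
  · rw [map_zero]

include hprod

/-- **Gauge covariance of `H(T, U; g, g', h; B)`**: a gauge with `g_↑ g_↓ = 1` acts on the hopping only.
[cite: Koma2022, §4.1 (4.1), §4.2 (4.5)–(4.9)] -/
theorem orbitalPhaseAut_hamiltonianC (T : Fin 2 → Λ → Λ → ℂ) (U g g' : ℝ) (h : Λ → Λ → ℝ) (B : ℝ) :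
    orbitalPhaseAut (g := spinSitePhase ph) (fun _ => hph _ _) (hamiltonianC G T U g g' h B) =
      hamiltonianC G (fun σ x y => ph σ x * star (ph σ y) * T σ x y) U g g' h B := by
  rw [hamiltonianC, hamiltonianC, map_add, orbitalPhaseAut_hamiltonian G hph hprod, orbitalPhaseAut_coulomb G hph]

/-- **Gauge invariance of the partition function** with the Coulomb term. [cite: Koma2022, §4.1–4.2] -/
theorem partitionFn_hamiltonianC_gauge (T : Fin 2 → Λ → Λ → ℂ) (U g g' : ℝ) (h : Λ → Λ → ℝ) (B β : ℝ) :
    (hamiltonianC G (fun σ x y => ph σ x * star (ph σ y) * T σ x y) U g g' h B).partitionFn β =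
      (hamiltonianC G T U g g' h B).partitionFn β := by
  rw [← orbitalPhaseAut_hamiltonianC G hph hprod T U g g' h B, orbitalPhaseAut_apply,
    ← star_eq_conjTranspose]
  exact partitionFn_unitary_conj (orbitalPhase_mem_unitary fun _ => hph _ _) β _

omit hph hprod in
/-- **`ℤ₂` gauge invariance of the partition function** with the Coulomb term. [cite: Koma2022, §4.1 (4.1), §4.2 (4.5)] -/
theorem partitionFn_hamiltonianC_signGauge (ε : Λ → ℝ) (hε : ∀ x, ε x = 1 ∨ ε x = -1)
    (T : Fin 2 → Λ → Λ → ℂ) (U g g' : ℝ) (h : Λ → Λ → ℝ) (B β : ℝ) :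
    (hamiltonianC G (fun σ x y => ((ε x * ε y : ℝ) : ℂ) * T σ x y) U g g' h B).partitionFn β =
      (hamiltonianC G T U g g' h B).partitionFn β := by
  have hn : ∀ (σ : Fin 2) (x : Λ), ‖(fun (_ : Fin 2) (x : Λ) => (ε x : ℂ)) σ x‖ = 1 := fun σ x => by
    rcases hε x with h1 | h1 <;> simp [h1]
  have hp : ∀ x : Λ, (fun (_ : Fin 2) (x : Λ) => (ε x : ℂ)) 0 x * (fun (_ : Fin 2) (x : Λ) => (ε x : ℂ)) 1 x = 1 :=
    fun x => by rcases hε x with h1 | h1 <;> simp [h1]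
  have key := partitionFn_hamiltonianC_gauge G hn hp T U g g' h B β
  have hT : (fun σ x y => (fun (_ : Fin 2) (x : Λ) => (ε x : ℂ)) σ x *
      star ((fun (_ : Fin 2) (x : Λ) => (ε x : ℂ)) σ y) * T σ x y) =
      fun σ x y => ((ε x * ε y : ℝ) : ℂ) * T σ x y := by
    funext σ x y
    simp only [Complex.star_def, Complex.conj_ofReal, Complex.ofReal_mul]
  rw [hT] at key
  exact key

end Gauge

end PairHopRP

/-! ### The `π`-flux model with the Coulomb term -/

namespace KomaPiFlux

attribute [local instance] LiebCutRP.decEqTorus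

variable {d L : ℕ} [NeZero L]

/-- **Koma's `π`-flux BCS model with the Coulomb repulsion, Lieb frame**:
`H(κ, U; g, g', h; B) = K(T_π(κ)) + UΣ(n-½)(n-½) + H_pair(g, h) - B·O + g'Σ_{bonds}Γ³_xΓ³_y`.
[cite: Koma2022, (2.4), (2.6), (3.6), (8.1), (8.3)] -/
def hamiltonianC (κ U g g' : ℝ) (h : FermionTorus (d + 1) L → FermionTorus (d + 1) L → ℝ) (B : ℝ) :
    Matrix (Finset (Orb (FermionTorus (d + 1) L))) (Finset (Orb (FermionTorus (d + 1) L))) ℂ :=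
  PairHopRP.hamiltonianC (G d L) (piFluxAmpl κ) U g g' h B

/-- `H(κ,U;g,g',h;B) = H(κ,U;g,h;B) + H_repul(g')`. [cite: Koma2022, (8.3)] -/
theorem hamiltonianC_eq (κ U g g' : ℝ) (h : FermionTorus (d + 1) L → FermionTorus (d + 1) L → ℝ) (B : ℝ) :
    hamiltonianC κ U g g' h B = hamiltonian κ U g h B + PairHopRP.coulomb (G d L) g' := rfl

/-- At `g' = 0` the Coulomb term vanishes. [cite: Koma2022, (8.1)] -/
theorem hamiltonianC_zero (κ U g : ℝ) (h : FermionTorus (d + 1) L → FermionTorus (d + 1) L → ℝ) (B : ℝ) :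
    hamiltonianC κ U g 0 h B = hamiltonian κ U g h B := by
  rw [hamiltonianC_eq, PairHopRP.coulomb]
  have h0 : ∀ x y : FermionTorus (d + 1) L, (if (G d L).Adj x y then PairHopRP.coulombBond 0 x y else 0) =
      (0 : Matrix (Finset (Orb (FermionTorus (d + 1) L))) _ ℂ) := fun x y => by
    split_ifs
    · rw [PairHopRP.coulombBond, zero_div, Complex.ofReal_zero, zero_smul]
    · rfl
  simp only [h0, Finset.sum_const_zero, add_zero]

/-- The model with the Coulomb term is Hermitian. [cite: Koma2022, (2.4), (8.3)] -/
theorem hamiltonianC_isHermitian (κ U g g' : ℝ) (h : FermionTorus (d + 1) L → FermionTorus (d + 1) L → ℝ) (B : ℝ) :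
    (hamiltonianC κ U g g' h B).IsHermitian :=
  PairHopRP.hamiltonianC_isHermitian (G d L) (piFluxAmpl κ) (piFluxAmpl_herm κ) U g g' h B

/-- `H(amplLL T_π) = H(T_π)` with the Coulomb term. [cite: Koma2022, (5.92)] -/
theorem hamiltonianC_amplLL (hL : Even L) (h4 : 4 ≤ L) (κ U g g' : ℝ)
    (h : FermionTorus (d + 1) L → FermionTorus (d + 1) L → ℝ) (B : ℝ) :
    PairHopRP.hamiltonianC (G d L) (amplLL (piFluxAmpl κ)) U g g' h B = hamiltonianC κ U g g' h B := by
  rw [hamiltonianC, PairHopRP.hamiltonianC, PairHopRP.hamiltonianC, ← hamiltonian, hamiltonian_amplLL hL h4,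
    hamiltonian]

/-- `H(amplRR T_π) = H(T_π)` with the Coulomb term. [cite: Koma2022, (5.92)] -/
theorem hamiltonianC_amplRR (hL : Even L) (h4 : 4 ≤ L) (κ U g g' : ℝ)
    (h : FermionTorus (d + 1) L → FermionTorus (d + 1) L → ℝ) (B : ℝ) :
    PairHopRP.hamiltonianC (G d L) (amplRR (piFluxAmpl κ)) U g g' h B = hamiltonianC κ U g g' h B := by
  rw [hamiltonianC, PairHopRP.hamiltonianC, PairHopRP.hamiltonianC, ← hamiltonian, hamiltonian_amplRR hL h4,
    hamiltonian]

/-- **(5.99) with the Coulomb term** ((8.4) at one plane): `Z(h)² ≤ Z(h_LL) Z(h_RR)` for `κ, g, g' ≥ 0`,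
`β ≥ 0`. [cite: Koma2022, Cor. 5.2 (5.99), §8 (8.4)] -/
theorem partitionFn_sq_le_coulomb (hL : Even L) (h4 : 4 ≤ L) {β : ℝ} (hβ : 0 ≤ β) {κ : ℝ} (hκ : 0 ≤ κ)
    (U : ℝ) {g : ℝ} (hg : 0 ≤ g) {g' : ℝ} (hg' : 0 ≤ g')
    (h : FermionTorus (d + 1) L → FermionTorus (d + 1) L → ℝ) (B : ℝ) :
    ((hamiltonianC κ U g g' h B).partitionFn β).re ^ 2 ≤
      ((hamiltonianC κ U g g' (fieldLL h) B).partitionFn β).re *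
        ((hamiltonianC κ U g g' (fieldRR h) B).partitionFn β).re := by
  have h := PairHopCutRP.partitionFn_sq_le_reflected_coulomb hL h4 hβ hg hg' (tc := fun _ _ => κ)
    (fun _ _ _ => hκ) U (piFluxAmpl κ) (piFluxAmpl_herm κ) (fun σ x hx => piFluxAmpl_cut hL h4 κ σ x hx) h B
  rwa [hamiltonianC_amplLL hL h4, hamiltonianC_amplRR hL h4] at h

/-- The `β → ∞` form with the Coulomb term. [cite: Koma2022, (2.13), Cor. 5.2, §8] -/
theorem groundEnergy_add_le_coulomb (hL : Even L) (h4 : 4 ≤ L) {κ : ℝ} (hκ : 0 ≤ κ) (U : ℝ) {g : ℝ} (hg : 0 ≤ g)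
    {g' : ℝ} (hg' : 0 ≤ g') (h : FermionTorus (d + 1) L → FermionTorus (d + 1) L → ℝ) (B : ℝ) :
    (hamiltonianC κ U g g' (fieldLL h) B).groundEnergy + (hamiltonianC κ U g g' (fieldRR h) B).groundEnergy ≤
      2 * (hamiltonianC κ U g g' h B).groundEnergy := by
  have h := PairHopCutRP.groundEnergy_add_le_two_mul_coulomb hL h4 hg hg' (tc := fun _ _ => κ)
    (fun _ _ _ => hκ) U (piFluxAmpl κ) (piFluxAmpl_herm κ) (fun σ x hx => piFluxAmpl_cut hL h4 κ σ x hx) h B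
  rwa [hamiltonianC_amplLL hL h4, hamiltonianC_amplRR hL h4] at h

/-! ### Symmetries -/

/-- **Invariance of the partition function under a symmetry of `T_π` up to a `ℤ₂` gauge**, with the
Coulomb term. [cite: Koma2022, §4.1 (4.1)–(4.4), §4.2 (4.5)–(4.9)] -/
theorem partitionFn_map_coulomb (h2 : 2 ≤ L) {f : FermionTorus (d + 1) L ≃ FermionTorus (d + 1) L}
    {π : Equiv.Perm (Fin (d + 1))} (hf : ∀ x ν, f (shift x ν) = shift (f x) (π ν))
    {ε : FermionTorus (d + 1) L → ℝ} (hε1 : ∀ x, ε x = 1 ∨ ε x = -1)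
    (hε : ∀ x ν, ε x * ε (shift x ν) * bondSign x ν = bondSign (f x) (π ν))
    (κ U g g' : ℝ) (h : FermionTorus (d + 1) L → FermionTorus (d + 1) L → ℝ) (B β : ℝ) :
    (hamiltonianC κ U g g' (fun x y => h (f x) (f y)) B).partitionFn β = (hamiltonianC κ U g g' h B).partitionFn β := by
  have step1 := PairHopRP.partitionFn_hamiltonianC_signGauge (G d L) ε hε1 (piFluxAmpl κ) U g g'
    (fun x y => h (f x) (f y)) B β
  have hT : (fun σ x' y' => ((ε x' * ε y' : ℝ) : ℂ) * piFluxAmpl κ σ x' y') =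
      fun σ x' y' => piFluxAmpl κ σ (f x') (f y') := by
    funext σ x' y'
    exact (piFluxAmpl_map κ hf hε σ x' y').symm
  rw [hT] at step1
  have hG : ∀ x y, (G d L).Adj (f.symm x) (f.symm y) ↔ (G d L).Adj x y := fun x y => by
    rw [← adj_map_iff h2 hf (f.symm x) (f.symm y), Equiv.apply_symm_apply, Equiv.apply_symm_apply]
  have step2 := PairHopRP.partitionFn_hamiltonianC_relabel (G d L) (G d L) f.symm hG (piFluxAmpl κ) U g g' h B β
  simp only [Equiv.symm_symm] at step2
  rw [hamiltonianC, hamiltonianC, ← step1]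
  exact step2

/-- Lattice-shift invariance with the Coulomb term. [cite: Koma2022, §4.1 (4.3)–(4.4)] -/
theorem partitionFn_translate_coulomb (hL : Even L) (h2 : 2 ≤ L) (κ U g g' : ℝ)
    (h : FermionTorus (d + 1) L → FermionTorus (d + 1) L → ℝ) (B β : ℝ) :
    (hamiltonianC κ U g g' (fun x y => h (shiftEquiv 0 x) (shiftEquiv 0 y)) B).partitionFn β =
      (hamiltonianC κ U g g' h B).partitionFn β :=
  partitionFn_map_coulomb h2 (π := 1) (fun x ν => shiftEquiv_zero_shift x ν) translateGauge_sign
    (translateGauge_bondSign hL) κ U g g' h B β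

/-- Direction-interchange invariance with the Coulomb term. [cite: Koma2022, §4.2 (4.5)–(4.9)] -/
theorem partitionFn_rotateAxes_coulomb (hL : Even L) (h2 : 2 ≤ L) (κ U g g' : ℝ)
    (h : FermionTorus (d + 1) L → FermionTorus (d + 1) L → ℝ) (B β : ℝ) :
    (hamiltonianC κ U g g' (fun x y => h (rotateAxes x) (rotateAxes y)) B).partitionFn β =
      (hamiltonianC κ U g g' h B).partitionFn β :=
  partitionFn_map_coulomb h2 rotateAxes_shift rotateGauge_sign (rotateGauge_bondSign hL) κ U g g' h B β

/-! ### Theorem 5.3 with the Coulomb term -/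

omit [NeZero L] in
/-- `x ≤ (y + z)/2` from `x² ≤ yz`, `y, z ≥ 0`. [folklore] -/
private theorem le_half_add_of_sq_le_mul'' {x y z : ℝ} (hy : 0 ≤ y) (hz : 0 ≤ z) (h : x ^ 2 ≤ y * z) :
    x ≤ (y + z) / 2 := by
  nlinarith [sq_nonneg (y - z), h, hy, hz, sq_nonneg (x - (y + z) / 2)]

/-- **Gaussian domination with the Coulomb repulsion (Koma Thm 5.3 + (8.4)), Lieb frame.** On the even
torus `(ℤ/Lℤ)^{d+1}`, `L ≥ 4`, for `κ ≥ 0`, `g ≥ 0`, `g' ≥ 0`, `β > 0`, any `U`, `B` and any real pair field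
`h`: `Z_β(T_π; U, g, g', h; B) ≤ Z_β(T_π; U, g, g', 0; B)`. [cite: Koma2022, Thm. 5.3 (5.100), §8 (8.4)]
[cite: DLS1978, Thm. 4.2] -/
theorem partitionFn_le_coulomb (hL : Even L) (h4 : 4 ≤ L) {β : ℝ} (hβ : 0 < β) {κ : ℝ} (hκ : 0 ≤ κ) (U : ℝ)
    {g : ℝ} (hg : 0 ≤ g) {g' : ℝ} (hg' : 0 ≤ g') (h : FermionTorus (d + 1) L → FermionTorus (d + 1) L → ℝ)
    (B : ℝ) :
    ((hamiltonianC κ U g g' h B).partitionFn β).re ≤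
      ((hamiltonianC κ U g g' (fun (_ _ : FermionTorus (d + 1) L) => (0 : ℝ)) B).partitionFn β).re := by
  have h2 : 2 ≤ L := by omega
  set E : (FermionTorus (d + 1) L → FermionTorus (d + 1) L → ℝ) → ℝ :=
    fun h' => -((hamiltonianC κ U g g' h' B).partitionFn β).re with hE
  have hRP : ∀ h', (E (fieldLL h') + E (fieldRR h')) / 2 ≤ E h' := fun h' => by
    have hsq := partitionFn_sq_le_coulomb hL h4 hβ.le hκ U hg hg' h' B
    have hyL : 0 ≤ ((hamiltonianC κ U g g' (fieldLL h') B).partitionFn β).re :=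
      (partitionFn_hamiltonianC_re_pos (piFluxAmpl κ) (piFluxAmpl_herm κ) U g g' (fieldLL h') B β).le
    have hyR : 0 ≤ ((hamiltonianC κ U g g' (fieldRR h') B).partitionFn β).re :=
      (partitionFn_hamiltonianC_re_pos (piFluxAmpl κ) (piFluxAmpl_herm κ) U g g' (fieldRR h') B β).le
    have := le_half_add_of_sq_le_mul'' hyL hyR hsq
    simp only [hE]
    linarith
  have h0 : ∀ h' : FermionTorus (d + 1) L → FermionTorus (d + 1) L → ℝ,
      (∀ x y, (G d L).Adj x y → h' x y = 0) → E h' = E (fun _ _ => 0) := fun h' hh => by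
    simp only [hE]
    rw [show hamiltonianC κ U g g' h' B = hamiltonianC κ U g g' (fun (_ _ : FermionTorus (d + 1) L) => (0 : ℝ)) B by
      rw [hamiltonianC_eq, hamiltonianC_eq]
      unfold hamiltonian PairHopRP.hamiltonian
      rw [pairInteraction_congr (G d L) hh]]
  have hτ : ∀ h', E (fun a b => h' (shiftEquiv 0 a) (shiftEquiv 0 b)) = E h' := fun h' => by
    simp only [hE]
    rw [partitionFn_translate_coulomb hL h2]
  have hρ : ∀ h', E (fun a b => h' (rotateAxes a) (rotateAxes b)) = E h' := fun h' => by
    simp only [hE]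
    rw [partitionFn_rotateAxes_coulomb hL h2]
  have key := gaussianDomination_descent hL h4 E hRP h0 (exists_symmetry_to_cut E hL h2 hτ hρ) h
  simp only [hE] at key
  linarith

/-- **The ground-state form**: `E₀(h = 0) ≤ E₀(h)` with the Coulomb term. [cite: Koma2022, Thm. 5.3, (2.13), §8] -/
theorem groundEnergy_le_coulomb (hL : Even L) (h4 : 4 ≤ L) {κ : ℝ} (hκ : 0 ≤ κ) (U : ℝ) {g : ℝ} (hg : 0 ≤ g)
    {g' : ℝ} (hg' : 0 ≤ g') (h : FermionTorus (d + 1) L → FermionTorus (d + 1) L → ℝ) (B : ℝ) :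
    (hamiltonianC κ U g g' (fun (_ _ : FermionTorus (d + 1) L) => (0 : ℝ)) B).groundEnergy ≤
      (hamiltonianC κ U g g' h B).groundEnergy :=
  haveI : Nonempty (Finset (Orb (FermionTorus (d + 1) L))) := ⟨∅⟩
  groundEnergy_le_of_forall_partitionFn_le (hamiltonianC_isHermitian κ U g g' h B)
    (hamiltonianC_isHermitian κ U g g' (fun (_ _ : FermionTorus (d + 1) L) => (0 : ℝ)) B)
    (fun _ hβ => partitionFn_le_coulomb hL h4 hβ hκ U hg hg' h B)

end KomaPiFlux

end Literature.MathematicalPhysics.QuantumLattice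

end
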